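import Summits.QuantumFields.QCD.Theses.HeatSlicedQuarks
import Literature.MathematicalPhysics.QuantumLattice.WilsonDiracAP
import Literature.MathematicalPhysics.QuantumFieldTheory.WilsonOddRPKernel
import Summits.QuantumFields.QCD.Theorems.QuarksAsStableActionMarginalSiteRP
import Summits.QuantumFields.QCD.Theorems.HeatSlicedQuarksInterleavedFlowProperStubFineWeightAdmissibleSymm
import Summits.QuantumFields.QCD.Theorems.HeatSlicedQuarksInterleavedFlowProperStubFineWeightAdmissibleRP
import Summits.QuantumFields.QCD.Theorems.HeatSlicedQuarksInterleavedFlowProperStubFineWeightAdmissiblePartitionAlgebra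
import Summits.QuantumFields.QCD.Theorems.HeatSlicedQuarksInterleavedFlowProperStubFineWeightAdmissibleGramData2
import HarnessLib

/-!
# Fine-weight admissibility, part 8: positivity of the signed partition function and the stub
`stub_fineWeightAdmissible` (crux stmt-QuantumFields-18031 `HeatSlicedQuarks.InterleavedFlowProper`,
line `Sketch`)

* `fineWeight_partitionPos` — clause (2) of the admissibility predicate `AdmAt` of
  `HeavyThresholdYMBridge.RobustYangMillsRG` for the fine weight of the line: on the odd torus
  `(ℤ/(2S+1))⁴`, `S ≥ 1`, at `β ≥ 0` and bare masses `m_f > -1`,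
  `0 < ∫ exp(-β S_W(U)) Re ∏_f det D_AP[U, m_f] ∏ dU_e` (quarks antiperiodic in all four
  directions). Lüscher's classical argument is `Z = Tr 𝕋^{2S+1} > 0` for his positive transfer
  matrix; here the positivity is obtained from reflection positivity alone: in the odd-torus kernel
  mechanism of the tree (`WilsonOddRP.integral_oddCovKernel_nonneg`) the Kronecker-product kernel of
  the flavours (parts 3–7) has the vacuum eigenvector `⊗_f v` with a positive eigenvalue `Λ(U)`;
  the kernel minus the dominated rank-one kernel `(Λ/‖⊗v‖²)(⊗v)(⊗v)ᴴ` is still positive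
  semidefinite (part 6), the mechanism applies to the difference, and the subtracted covariant
  form is the observable `(Λ(U)/‖⊗v‖²) H(U) H(ΘU)` with `H = ∏_f h_f` bounded below by a positive
  constant — so the partition function dominates the integral of a pointwise positive function.
* `stub_fineWeightAdmissible` — the registered stub of the skeleton (clauses (1)–(6)), assembled
  from parts 1 (measurability and symmetries), 5 (reflection positivity) and the above.

References: M. Lüscher, Commun. Math. Phys. 54 (1977) 283, §3; K. Osterwalder, E. Seiler,
Ann. Phys. 110 (1978) 440, §2; I. Montvay, G. Münster, *Quantum Fields on a Lattice* (1994)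
§4.2.3–4.2.4. All statements are proved; no definitions, no named facts.
-/

noncomputable section

-- The Gram index types are too deep for the default instance-search bounds (`DecidableEq` /
-- `Fintype` of the function type of row selections), cf. the tree's `QuarksAsStableActionMarginalSiteRP`.
set_option synthInstance.maxSize 2048
set_option synthInstance.maxHeartbeats 100000

namespace Summit.QuantumFields.QCD.Cruxes.InterleavedFlowProper.OffsetLastFormatHandover

open Literature.MathematicalPhysics.QuantumFieldTheory Literature.MathematicalPhysics.QuantumLattice
  Literature.MathematicalPhysics.AQFT
open Literature.Probability.LatticeModels Literature.LinearAlgebra.Matrix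
open Filter Topology MeasureTheory Matrix Complex Finset
open scoped ComplexOrder ComplexConjugate

/-! ## Clause (2): strict positivity of the signed partition function on the odd torus -/

section PartitionPos

open FineWeight

/-- Factorisation of the rank-one part of a covariant Gram form:
`∑_{I,J} a_I conj b_J (c V_I conj V_J) = c (∑_I a_I V_I) conj (∑_J b_J V_J)`. -/
theorem sum_sum_mul_conj_rankOne {𝓘 : Type*} [Fintype 𝓘] (a b V : 𝓘 → ℂ) (c : ℂ) :
    ∑ I, ∑ J, a I * conj (b J) * (c * (V I * conj (V J))) = c * (∑ I, a I * V I) * conj (∑ J, b J * V J) := by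
  rw [map_sum, mul_assoc, Finset.sum_mul_sum, Finset.mul_sum]
  refine Finset.sum_congr rfl fun I _ => ?_
  rw [Finset.mul_sum]
  refine Finset.sum_congr rfl fun J _ => ?_
  rw [map_mul]
  ring

/-- **Clause (2): the signed partition function of `N_f` flavours of all-axes-antiperiodic Wilson
quarks on the odd torus `(ℤ/(2S+1))⁴` is strictly positive** (`β ≥ 0`, `m_f > -1`, `S ≥ 1`):
`0 < ∫ exp(-β S_W(U)) Re ∏_f det D_AP[U, m_f] ∏ dU_e`. Proof: in the odd-torus kernel mechanism
(part 5) the Kronecker-product kernel of the flavours has the vacuum eigenvector `⊗_f v` with the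
positive eigenvalue `Λ(U) = ∏_f λ_f(U)` (part 7, `exists_oddGramData₂`); subtracting the dominated
rank-one kernel `(Λ/‖⊗v‖²) (⊗v)(⊗v)ᴴ` (part 6) keeps the mechanism applicable, and the subtracted
covariant form is the observable `(Λ(U)/‖⊗v‖²) H(U) H(ΘU)`, `H = ∏_f h_f > 0` the vacuum component
of the feature vector. Hence the partition function is at least the integral of a function bounded
below by a positive constant (Lüscher's `Z = Tr 𝕋^N > 0`, here from reflection positivity alone). -/
theorem fineWeight_partitionPos {Nf : ℕ} (β : ℝ) (mq : Fin Nf → ℝ) (hβ : 0 ≤ β) (hmq : ∀ f, -1 < mq f)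
    (S : ℕ) (hS : 1 ≤ S) :
    0 < ∫ U : GaugeConfig 4 (2 * S + 1) (Matrix.specialUnitaryGroup (Fin 3) ℂ),
      Real.exp (-(β * wilsonAction (fundamentalRep (Fin 3)) U)) * (∏ f, fermionDet (wilsonDiracAP U (mq f))).re
        ∂(Measure.pi fun _ => haarProbability (Matrix.specialUnitaryGroup (Fin 3) ℂ)) := by
  classical
  haveI : Fact (1 < 2 * S + 1) := ⟨by omega⟩
  have hodd : Odd (2 * S + 1) := ⟨S, rfl⟩
  -- the Gram data of the flavours with their vacuum data
  choose Φ K v lam h hΦm hKm hΦb hKb hΦdep hKdep hKpsd hgram hvre hvb hv1 hlamm hhm hlam0 hlamC hh0 hhC hlamdep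
    hhdep heig hvac using fun f => exists_oddGramData₂ (S := S) (N := 3) hS (hmq f)
  choose CΦ hCΦ using hΦb
  choose CK hCK using hKb
  choose Cv hCv using hvb
  choose l₀ hl₀ hl₀le using hlam0
  choose Cl hCl using hlamC
  choose h₀ hh₀ hh₀le using hh0
  choose Ch hCh using hhC
  have hl0 : ∀ f X, 0 ≤ lam f X := fun f X => (hl₀ f).le.trans (hl₀le f X)
  have hh0' : ∀ f X, 0 ≤ h f X := fun f X => (hh₀ f).le.trans (hh₀le f X)
  have hCv0 : ∀ f, 0 ≤ Cv f := fun f => (norm_nonneg _).trans (hCv f Sum.inl)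
  -- the objects of the mechanism
  set g : (Fin Nf → ((((Fin 3 → ZMod (2 * S + 1)) × Fin 3) × Fin 2) ⊕ (((Fin 3 → ZMod (2 * S + 1)) × Fin 3) × Fin 2)) →
      (((((Fin 3 → ZMod (2 * S + 1)) × Fin 3) × Fin 2) ⊕ (((Fin 3 → ZMod (2 * S + 1)) × Fin 3) × Fin 2)) ⊕
        ((((Fin 3 → ZMod (2 * S + 1)) × Fin 3) × Fin 2) ⊕ (((Fin 3 → ZMod (2 * S + 1)) × Fin 3) × Fin 2)))) → GaugeConfig 4 (2 * S + 1) (Matrix.specialUnitaryGroup (Fin 3) ℂ) → ℂ := fun I X => ∏ f, Φ f (I f) X with hg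
  set Vv : (Fin Nf → ((((Fin 3 → ZMod (2 * S + 1)) × Fin 3) × Fin 2) ⊕ (((Fin 3 → ZMod (2 * S + 1)) × Fin 3) × Fin 2)) →
      (((((Fin 3 → ZMod (2 * S + 1)) × Fin 3) × Fin 2) ⊕ (((Fin 3 → ZMod (2 * S + 1)) × Fin 3) × Fin 2)) ⊕
        ((((Fin 3 → ZMod (2 * S + 1)) × Fin 3) × Fin 2) ⊕ (((Fin 3 → ZMod (2 * S + 1)) × Fin 3) × Fin 2)))) → ℂ := fun I => ∏ f, v f (I f) with hVv
  set Λ : GaugeConfig 4 (2 * S + 1) (Matrix.specialUnitaryGroup (Fin 3) ℂ) → ℝ := fun X => ∏ f, lam f X with hΛ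
  set Hh : GaugeConfig 4 (2 * S + 1) (Matrix.specialUnitaryGroup (Fin 3) ℂ) → ℝ := fun X => ∏ f, h f X with hHh
  set ν : ℂ := star Vv ⬝ᵥ Vv with hν
  set Pk : (Fin Nf → ((((Fin 3 → ZMod (2 * S + 1)) × Fin 3) × Fin 2) ⊕ (((Fin 3 → ZMod (2 * S + 1)) × Fin 3) × Fin 2)) →
      (((((Fin 3 → ZMod (2 * S + 1)) × Fin 3) × Fin 2) ⊕ (((Fin 3 → ZMod (2 * S + 1)) × Fin 3) × Fin 2)) ⊕
        ((((Fin 3 → ZMod (2 * S + 1)) × Fin 3) × Fin 2) ⊕ (((Fin 3 → ZMod (2 * S + 1)) × Fin 3) × Fin 2)))) → (Fin Nf → ((((Fin 3 → ZMod (2 * S + 1)) × Fin 3) × Fin 2) ⊕ (((Fin 3 → ZMod (2 * S + 1)) × Fin 3) × Fin 2)) →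
      (((((Fin 3 → ZMod (2 * S + 1)) × Fin 3) × Fin 2) ⊕ (((Fin 3 → ZMod (2 * S + 1)) × Fin 3) × Fin 2)) ⊕
        ((((Fin 3 → ZMod (2 * S + 1)) × Fin 3) × Fin 2) ⊕ (((Fin 3 → ZMod (2 * S + 1)) × Fin 3) × Fin 2)))) → GaugeConfig 4 (2 * S + 1) (Matrix.specialUnitaryGroup (Fin 3) ℂ) → ℂ :=
    fun I J X => (∏ f, K f (I f) (J f) X) - (Λ X : ℂ) / ν * (Vv I * conj (Vv J)) with hPk
  set Φfull : GaugeConfig 4 (2 * S + 1) (Matrix.specialUnitaryGroup (Fin 3) ℂ) → ℂ := fun X => ∏ f, fermionDet (wilsonDiracAP X (mq f)) with hΦfull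
  set Φ₀ : GaugeConfig 4 (2 * S + 1) (Matrix.specialUnitaryGroup (Fin 3) ℂ) → ℂ := fun X => (Λ X : ℂ) / ν * ((Hh X * Hh X.timeReflect : ℝ) : ℂ) with hΦ₀
  -- `ν` is a real number `≥ 1`
  have hVre : ∀ I, conj (Vv I) = Vv I := fun I => by rw [hVv, map_prod]; exact Finset.prod_congr rfl fun f _ => hvre f _
  have hV1 : Vv (fun _ => Sum.inl) = 1 := Finset.prod_eq_one fun f _ => hv1 f
  have hν1 : (1 : ℂ) ≤ ν := by
    rw [hν, dotProduct]
    calc (1 : ℂ) = star (Vv fun _ => Sum.inl) * Vv (fun _ => Sum.inl) := by rw [hV1, star_one, one_mul]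
      _ ≤ ∑ I, star (Vv I) * Vv I :=
        Finset.single_le_sum (f := fun I => star (Vv I) * Vv I) (fun I _ => star_mul_self_nonneg (Vv I)) (Finset.mem_univ _)
  have hνre : ((ν.re : ℝ) : ℂ) = ν := Complex.ext (by simp) (by simpa using (Complex.le_def.1 hν1).2)
  have hνpos : 0 < ν.re := by have h := (Complex.le_def.1 hν1).1; simp at h; linarith
  have hνnorm : ‖ν‖ = ν.re := by
    conv_lhs => rw [← hνre]
    rw [Complex.norm_real, Real.norm_eq_abs, abs_of_pos hνpos]
  -- the vacuum vector is an eigenvector of the flavour kernel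
  have heig' : ∀ X, (Matrix.of fun I J : Fin Nf → ((((Fin 3 → ZMod (2 * S + 1)) × Fin 3) × Fin 2) ⊕ (((Fin 3 → ZMod (2 * S + 1)) × Fin 3) × Fin 2)) →
      (((((Fin 3 → ZMod (2 * S + 1)) × Fin 3) × Fin 2) ⊕ (((Fin 3 → ZMod (2 * S + 1)) × Fin 3) × Fin 2)) ⊕
        ((((Fin 3 → ZMod (2 * S + 1)) × Fin 3) × Fin 2) ⊕ (((Fin 3 → ZMod (2 * S + 1)) × Fin 3) × Fin 2))) => ∏ f, K f (I f) (J f) X) *ᵥ Vv = (Λ X : ℂ) • Vv := fun X => by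
    funext I
    simp only [Matrix.mulVec, dotProduct, Matrix.of_apply, Pi.smul_apply, smul_eq_mul, hVv, hΛ, Complex.ofReal_prod,
      ← Finset.prod_mul_distrib]
    rw [← Fintype.prod_sum fun f q => K f (I f) q X * v f q]
    exact Finset.prod_congr rfl fun f _ => heig f X (I f)
  have hpsd : ∀ X, (Matrix.of fun I J : Fin Nf → ((((Fin 3 → ZMod (2 * S + 1)) × Fin 3) × Fin 2) ⊕ (((Fin 3 → ZMod (2 * S + 1)) × Fin 3) × Fin 2)) →
      (((((Fin 3 → ZMod (2 * S + 1)) × Fin 3) × Fin 2) ⊕ (((Fin 3 → ZMod (2 * S + 1)) × Fin 3) × Fin 2)) ⊕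
        ((((Fin 3 → ZMod (2 * S + 1)) × Fin 3) × Fin 2) ⊕ (((Fin 3 → ZMod (2 * S + 1)) × Fin 3) × Fin 2))) => ∏ f, K f (I f) (J f) X).PosSemidef := fun X => by
    have h := Summit.QuantumFields.QCD.Theorems.posSemidef_piProd (fun f => Matrix.of fun q' q => K f q' q X) fun f => hKpsd f X
    simpa only [Matrix.of_apply] using h
  -- the vacuum component of the feature vector
  have hvacg : ∀ X, ∑ I, g I X * Vv I = (Hh X : ℂ) := fun X => by
    simp only [hg, hVv, hHh, Complex.ofReal_prod, ← Finset.prod_mul_distrib]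
    rw [← Fintype.prod_sum fun f q => Φ f q X * v f q]
    exact Finset.prod_congr rfl fun f _ => by rw [← hvac f X]; exact Finset.sum_congr rfl fun q _ => mul_comm _ _
  -- invariances under the split, the splice and the reflection of the split
  have hΛdep : ∀ U V : GaugeConfig 4 (2 * S + 1) (Matrix.specialUnitaryGroup (Fin 3) ℂ), (∀ e : Edge 4 (2 * S + 1), e.2 ≠ 0 → (e.1 0).val = S + 1 → U e = V e) → Λ U = Λ V :=
    fun U V hUV => Finset.prod_congr rfl fun f _ => hlamdep f U V hUV
  have hHdep : ∀ U V : GaugeConfig 4 (2 * S + 1) (Matrix.specialUnitaryGroup (Fin 3) ℂ), (∀ e : Edge 4 (2 * S + 1), e.2 ≠ 0 → U e = V e) → Hh U = Hh V :=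
    fun U V hUV => Finset.prod_congr rfl fun f _ => hhdep f U V hUV
  have hnc : ∀ e : Edge 4 (2 * S + 1), e.2 ≠ 0 → ¬ WilsonRP.IsLowerCross e := fun e he hc => he hc.1
  have hΛtrans : ∀ Y U, Λ (WilsonOddRP.translateLow Y U) = Λ U := fun Y U =>
    hΛdep _ _ fun e he _ => WilsonOddRP.translateLow_apply_of_not_isLowerCross Y U (hnc e he)
  have hHtrans : ∀ Y U, Hh (WilsonOddRP.translateLow Y U) = Hh U := fun Y U =>
    hHdep _ _ fun e he => WilsonOddRP.translateLow_apply_of_not_isLowerCross Y U (hnc e he)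
  have hHz : ∀ U Y, Hh (LatticeRP.splice WilsonOddRP.lowerEdges (U, Y)) = Hh U := fun U Y =>
    hHdep _ _ fun e he => WilsonOddRP.splice_apply_of_not_isLowerCross U Y (hnc e he)
  have hHΘtrans : ∀ Y U, Hh (WilsonOddRP.translateLow Y U).timeReflect = Hh U.timeReflect := fun Y U =>
    hHdep _ _ fun e he => by
      simp only [GaugeConfig.timeReflect, he, ↓reduceIte]
      exact WilsonOddRP.translateLow_apply_of_not_isLowerCross Y U (hnc _ he)
  -- the mechanism with the rank-one-subtracted kernel
  have hΛm : Measurable Λ := Finset.measurable_prod _ fun f _ => hlamm f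
  have hHm : Measurable Hh := Finset.measurable_prod _ fun f _ => hhm f
  have hΛle : ∀ X, Λ X ≤ ∏ f, Cl f := fun X => Finset.prod_le_prod (fun f _ => hl0 f X) fun f _ => hCl f X
  have hΛge : ∀ X, ∏ f, l₀ f ≤ Λ X := fun X => Finset.prod_le_prod (fun f _ => (hl₀ f).le) fun f _ => hl₀le f X
  have hHle : ∀ X, Hh X ≤ ∏ f, Ch f := fun X => Finset.prod_le_prod (fun f _ => hh0' f X) fun f _ => hCh f X
  have hHge : ∀ X, ∏ f, h₀ f ≤ Hh X := fun X => Finset.prod_le_prod (fun f _ => (hh₀ f).le) fun f _ => hh₀le f X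
  have hΛ0 : ∀ X, 0 ≤ Λ X := fun X => Finset.prod_nonneg fun f _ => hl0 f X
  have hH0 : ∀ X, 0 ≤ Hh X := fun X => Finset.prod_nonneg fun f _ => hh0' f X
  have hVb : ∀ I, ‖Vv I‖ ≤ ∏ f, Cv f := fun I => Summit.QuantumFields.QCD.Theorems.norm_prod_le_prod_of_le fun f => hCv f (I f)
  have key := WilsonOddRP.integral_oddCovKernel_nonneg (fundamentalRep (Fin 3)) hodd (continuous_fundamentalRep (Fin 3)) hβ
    (𝓘 := Fin Nf → ((((Fin 3 → ZMod (2 * S + 1)) × Fin 3) × Fin 2) ⊕ (((Fin 3 → ZMod (2 * S + 1)) × Fin 3) × Fin 2)) →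
      (((((Fin 3 → ZMod (2 * S + 1)) × Fin 3) × Fin 2) ⊕ (((Fin 3 → ZMod (2 * S + 1)) × Fin 3) × Fin 2)) ⊕
        ((((Fin 3 → ZMod (2 * S + 1)) × Fin 3) × Fin 2) ⊕ (((Fin 3 → ZMod (2 * S + 1)) × Fin 3) × Fin 2)))) (g := g) (Pk := Pk)
    (Kg := max (∏ f, CΦ f) ((∏ f, CK f) + (∏ f, Cl f) / ν.re * ((∏ f, Cv f) * (∏ f, Cv f)))) (Φ := fun X => Φfull X - Φ₀ X)
    (fun I => Finset.measurable_prod _ fun f _ => hΦm f (I f))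
    (fun I J => (Finset.measurable_prod _ fun f _ => hKm f (I f) (J f)).sub
      ((((Complex.measurable_ofReal.comp hΛm).div_const ν).mul_const _)))
    (fun I V => (Summit.QuantumFields.QCD.Theorems.norm_prod_le_prod_of_le fun f => hCΦ f (I f) V).trans (le_max_left _ _))
    (fun I J V => by
      refine (norm_sub_le _ _).trans ((add_le_add (Summit.QuantumFields.QCD.Theorems.norm_prod_le_prod_of_le
        fun f => hCK f (I f) (J f) V) ?_).trans (le_max_right _ _))
      rw [norm_mul, norm_div, Complex.norm_real, Real.norm_eq_abs, abs_of_nonneg (hΛ0 V), hνnorm, norm_mul,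
        Complex.norm_conj]
      exact mul_le_mul (div_le_div_of_nonneg_right (hΛle V) hνpos.le) (mul_le_mul (hVb I) (hVb J) (norm_nonneg _)
        ((norm_nonneg _).trans (hVb I))) (mul_nonneg (norm_nonneg _) (norm_nonneg _))
        (div_nonneg (Finset.prod_nonneg fun f _ => (hl0 f V).trans (hCl f V)) hνpos.le))
    (fun I U V hUV => by
      simp only [hg, fun f => hΦdep f (I f) (fun e he => hUV e (by rw [Finset.coe_union, Set.mem_union]; exact Or.inl he))])
    (fun I J U V hUV => by
      simp only [hPk, fun f => hKdep f (I f) (J f) hUV, hΛdep U V (fun e he1 he2 => hUV e (by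
        rw [Finset.mem_coe, WilsonOddRP.mem_oSharedEdges, WilsonOddRP.IsOSharedEdge]; exact ⟨he1, by omega⟩))])
    (fun V x => by simpa only [Matrix.of_apply] using sum_mul_conj_mul_sub_rankOne_nonneg (hpsd V) (heig' V) x)
    ((Finset.measurable_prod _ fun f _ => measurable_fermionDet_wilsonDiracAP (mq f)).sub
      ((((Complex.measurable_ofReal.comp hΛm).div_const ν).mul
        (Complex.measurable_ofReal.comp (hHm.mul (hHm.comp WilsonRP.measurable_timeReflect))))))
    (fun U Y => by
      have hfull : Φfull (WilsonOddRP.translateLow Y U) = ∑ I, ∑ J,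
          g I (LatticeRP.splice WilsonOddRP.lowerEdges (U, Y)) * conj (g J U.timeReflect) * ∏ f, K f (I f) (J f) U := by
        simp only [hΦfull, hg, hgram _ U Y]
        rw [Fintype.prod_sum]
        refine Finset.sum_congr rfl fun I _ => ?_
        rw [Fintype.prod_sum]
        refine Finset.sum_congr rfl fun J _ => ?_
        rw [Finset.prod_mul_distrib, Finset.prod_mul_distrib, map_prod]
        ring
      simp only [hPk, mul_sub, Finset.sum_sub_distrib]
      rw [hfull, sum_sum_mul_conj_rankOne, hvacg, hvacg, hHz, Complex.conj_ofReal]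
      simp only [hΦ₀, hΛtrans, hHtrans, hHΘtrans]
      push_cast
      ring)
  -- integrability of the two pieces
  set μ : Measure (GaugeConfig 4 (2 * S + 1) (Matrix.specialUnitaryGroup (Fin 3) ℂ)) :=
    Measure.pi fun _ => haarProbability (Matrix.specialUnitaryGroup (Fin 3) ℂ) with hμ
  obtain ⟨B, hB⟩ := exists_abs_wilsonAction_le (d := 4) (L := 2 * S + 1) (fundamentalRep (Fin 3))
    (continuous_fundamentalRep (Fin 3))
  have hexp_le : ∀ X : GaugeConfig 4 (2 * S + 1) (Matrix.specialUnitaryGroup (Fin 3) ℂ),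
      Real.exp (-β * wilsonAction (fundamentalRep (Fin 3)) X) ≤ Real.exp (β * B) := fun X =>
    Real.exp_le_exp.2 (by nlinarith [(abs_le.1 (hB X)).1])
  have hexp_ge : ∀ X : GaugeConfig 4 (2 * S + 1) (Matrix.specialUnitaryGroup (Fin 3) ℂ),
      Real.exp (-(β * B)) ≤ Real.exp (-(β * wilsonAction (fundamentalRep (Fin 3)) X)) := fun X =>
    Real.exp_le_exp.2 (by nlinarith [(abs_le.1 (hB X)).2])
  have hSm : Measurable fun X : GaugeConfig 4 (2 * S + 1) (Matrix.specialUnitaryGroup (Fin 3) ℂ) =>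
      wilsonAction (fundamentalRep (Fin 3)) X :=
    WilsonRP.measurable_wilsonAction (fundamentalRep (Fin 3)) (continuous_fundamentalRep (Fin 3))
  haveI := opensMeasurableSpace_gaugeConfig' (L := 2 * S + 1) (N := 3)
  obtain ⟨CD, hCD⟩ : ∃ C : ℝ, ∀ X, ‖Φfull X‖ ≤ C := by
    obtain ⟨C, hC⟩ := isCompact_univ.exists_bound_of_continuousOn
      ((continuous_finsetProd _ fun f _ => continuous_fermionDet_wilsonDiracAP (N := 3) (L := 2 * S + 1) (mq f)).continuousOn)
    exact ⟨C, fun X => by simpa only [hΦfull] using hC X (Set.mem_univ X)⟩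
  have hΦfullm : Measurable Φfull := Finset.measurable_prod _ fun f _ => measurable_fermionDet_wilsonDiracAP (mq f)
  have hΦ₀m : Measurable Φ₀ := ((Complex.measurable_ofReal.comp hΛm).div_const ν).mul
    (Complex.measurable_ofReal.comp (hHm.mul (hHm.comp WilsonRP.measurable_timeReflect)))
  have hexpm : Measurable fun X : GaugeConfig 4 (2 * S + 1) (Matrix.specialUnitaryGroup (Fin 3) ℂ) =>
      (Real.exp (-β * wilsonAction (fundamentalRep (Fin 3)) X) : ℂ) :=
    Complex.measurable_ofReal.comp (hSm.const_mul (-β)).exp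
  have hΦ₀b : ∀ X, ‖Φ₀ X‖ ≤ (∏ f, Cl f) / ν.re * ((∏ f, Ch f) * (∏ f, Ch f)) := fun X => by
    simp only [hΦ₀]
    rw [norm_mul, norm_div, Complex.norm_real, Real.norm_eq_abs, abs_of_nonneg (hΛ0 X), hνnorm, Complex.norm_real,
      Real.norm_eq_abs, abs_of_nonneg (mul_nonneg (hH0 X) (hH0 _))]
    exact mul_le_mul (div_le_div_of_nonneg_right (hΛle X) hνpos.le) (mul_le_mul (hHle X) (hHle _) (hH0 _)
      ((hH0 X).trans (hHle X))) (mul_nonneg (hH0 X) (hH0 _))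
      (div_nonneg (Finset.prod_nonneg fun f _ => (hl0 f X).trans (hCl f X)) hνpos.le)
  have hint1 : Integrable (fun X => (Real.exp (-β * wilsonAction (fundamentalRep (Fin 3)) X) : ℂ) * Φfull X) μ :=
    Integrable.of_bound (hexpm.mul hΦfullm).aestronglyMeasurable (Real.exp (β * B) * CD) (ae_of_all _ fun X => by
      rw [norm_mul, Complex.norm_real, Real.norm_eq_abs, abs_of_pos (Real.exp_pos _)]
      exact mul_le_mul (hexp_le X) (hCD X) (norm_nonneg _) (Real.exp_pos _).le)
  have hint0 : Integrable (fun X => (Real.exp (-β * wilsonAction (fundamentalRep (Fin 3)) X) : ℂ) * Φ₀ X) μ :=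
    Integrable.of_bound (hexpm.mul hΦ₀m).aestronglyMeasurable
      (Real.exp (β * B) * ((∏ f, Cl f) / ν.re * ((∏ f, Ch f) * (∏ f, Ch f)))) (ae_of_all _ fun X => by
      rw [norm_mul, Complex.norm_real, Real.norm_eq_abs, abs_of_pos (Real.exp_pos _)]
      exact mul_le_mul (hexp_le X) (hΦ₀b X) (norm_nonneg _) (Real.exp_pos _).le)
  have hsplit : ∫ X, (Real.exp (-β * wilsonAction (fundamentalRep (Fin 3)) X) : ℂ) * (Φfull X - Φ₀ X) ∂μ =
      (∫ X, (Real.exp (-β * wilsonAction (fundamentalRep (Fin 3)) X) : ℂ) * Φfull X ∂μ) -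
        ∫ X, (Real.exp (-β * wilsonAction (fundamentalRep (Fin 3)) X) : ℂ) * Φ₀ X ∂μ := by
    simp_rw [mul_sub]
    exact integral_sub hint1 hint0
  rw [hsplit, sub_nonneg] at key
  -- both pieces are real integrals
  have hfullR : ∫ X, (Real.exp (-β * wilsonAction (fundamentalRep (Fin 3)) X) : ℂ) * Φfull X ∂μ =
      ((∫ X, Real.exp (-(β * wilsonAction (fundamentalRep (Fin 3)) X)) * (∏ f, fermionDet (wilsonDiracAP X (mq f))).re ∂μ : ℝ) : ℂ) := by
    rw [← integral_complex_ofReal]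
    refine integral_congr_ae (ae_of_all _ fun X => ?_)
    have hr := prod_fermionDet_wilsonDiracAP_eq_re X mq
    simp only [hΦfull]
    conv_lhs => rw [hr]
    rw [neg_mul]
    push_cast
    ring
  have h0R : ∫ X, (Real.exp (-β * wilsonAction (fundamentalRep (Fin 3)) X) : ℂ) * Φ₀ X ∂μ =
      ((∫ X, Real.exp (-(β * wilsonAction (fundamentalRep (Fin 3)) X)) * (Λ X / ν.re * (Hh X * Hh X.timeReflect)) ∂μ : ℝ) : ℂ) := by
    rw [← integral_complex_ofReal]
    refine integral_congr_ae (ae_of_all _ fun X => ?_)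
    simp only [hΦ₀]
    conv_lhs => rw [← hνre]
    rw [neg_mul]
    push_cast
    ring
  rw [hfullR, h0R, Complex.real_le_real] at key
  -- the subtracted piece is bounded below by a positive constant
  have hε₀ : 0 < Real.exp (-(β * B)) * ((∏ f, l₀ f) / ν.re * ((∏ f, h₀ f) * (∏ f, h₀ f))) :=
    mul_pos (Real.exp_pos _) (mul_pos (div_pos (Finset.prod_pos fun f _ => hl₀ f) hνpos)
      (mul_pos (Finset.prod_pos fun f _ => hh₀ f) (Finset.prod_pos fun f _ => hh₀ f)))
  have hε : ∀ X : GaugeConfig 4 (2 * S + 1) (Matrix.specialUnitaryGroup (Fin 3) ℂ),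
      Real.exp (-(β * B)) * ((∏ f, l₀ f) / ν.re * ((∏ f, h₀ f) * (∏ f, h₀ f))) ≤
        Real.exp (-(β * wilsonAction (fundamentalRep (Fin 3)) X)) * (Λ X / ν.re * (Hh X * Hh X.timeReflect)) := fun X =>
    mul_le_mul (hexp_ge X) (mul_le_mul (div_le_div_of_nonneg_right (hΛge X) hνpos.le)
      (mul_le_mul (hHge X) (hHge _) (Finset.prod_nonneg fun f _ => (hh₀ f).le) (hH0 X))
      (mul_nonneg (Finset.prod_nonneg fun f _ => (hh₀ f).le) (Finset.prod_nonneg fun f _ => (hh₀ f).le))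
      (div_nonneg (hΛ0 X) hνpos.le))
      (mul_nonneg (div_nonneg (Finset.prod_nonneg fun f _ => (hl₀ f).le) hνpos.le)
        (mul_nonneg (Finset.prod_nonneg fun f _ => (hh₀ f).le) (Finset.prod_nonneg fun f _ => (hh₀ f).le)))
      (Real.exp_pos _).le
  have hr₀m : Measurable fun X : GaugeConfig 4 (2 * S + 1) (Matrix.specialUnitaryGroup (Fin 3) ℂ) =>
      Real.exp (-(β * wilsonAction (fundamentalRep (Fin 3)) X)) * (Λ X / ν.re * (Hh X * Hh X.timeReflect)) :=
    (hSm.const_mul β).neg.exp.mul ((hΛm.div_const _).mul (hHm.mul (hHm.comp WilsonRP.measurable_timeReflect)))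
  have hr₀int : Integrable (fun X : GaugeConfig 4 (2 * S + 1) (Matrix.specialUnitaryGroup (Fin 3) ℂ) =>
      Real.exp (-(β * wilsonAction (fundamentalRep (Fin 3)) X)) * (Λ X / ν.re * (Hh X * Hh X.timeReflect))) μ :=
    Integrable.of_bound hr₀m.aestronglyMeasurable
      (Real.exp (β * B) * ((∏ f, Cl f) / ν.re * ((∏ f, Ch f) * (∏ f, Ch f)))) (ae_of_all _ fun X => by
      rw [Real.norm_eq_abs, abs_of_nonneg (le_trans hε₀.le (hε X)), ← neg_mul]
      exact mul_le_mul (hexp_le X) (mul_le_mul (div_le_div_of_nonneg_right (hΛle X) hνpos.le)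
        (mul_le_mul (hHle X) (hHle _) (hH0 _) ((hH0 X).trans (hHle X))) (mul_nonneg (hH0 X) (hH0 _))
        (div_nonneg (Finset.prod_nonneg fun f _ => (hl0 f X).trans (hCl f X)) hνpos.le))
        (mul_nonneg (div_nonneg (hΛ0 X) hνpos.le) (mul_nonneg (hH0 X) (hH0 _))) (Real.exp_pos _).le)
  have hP₀ := integral_mono (integrable_const _) hr₀int hε
  rw [integral_const, probReal_univ, one_smul] at hP₀
  exact lt_of_lt_of_le (lt_of_lt_of_le hε₀ hP₀) key

end PartitionPos

/-! ## The stub -/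

section Stub

/-- **Stub `stub_fineWeightAdmissible` of the skeleton of line `Sketch`** (crux
`HeatSlicedQuarks.InterleavedFlowProper`): clauses (1)–(6) of the admissibility predicate `AdmAt` of
`HeavyThresholdYMBridge.RobustYangMillsRG` for the all-axes-antiperiodic quark-integrated Wilson
weight `w(U) = exp(-β S_W(U)) Re ∏_f det D_AP[U, m_f]` on the odd torus `(ℤ/(2S+1))⁴`, `S ≥ 1`,
`β ≥ 0`, `m_f > -1`: measurability, positivity of the total mass, invariance under translations,
under the link time reflection and under the permutations of the four axes, and reflection
positivity on bounded measurable positive-time link functions — all PROVED (parts 1–8). -/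
theorem stub_fineWeightAdmissible :
    ∀ (Nf : ℕ) (β : ℝ) (mq : Fin Nf → ℝ), 0 ≤ β → (∀ f, -1 < mq f) → ∀ (S : ℕ), 1 ≤ S →
      let G := ↥(Matrix.specialUnitaryGroup (Fin 3) ℂ)
      let ρ : G →* Matrix (Fin 3) (Fin 3) ℂ := fundamentalRep (Fin 3)
      let N : ℕ := 2 * S + 1
      let μ : Measure (GaugeConfig 4 N G) := Measure.pi fun _ => haarProbability G
      let apU : GaugeConfig 4 N G → GaugeConfig 4 N (Matrix.unitaryGroup (Fin 3) ℂ) := fun U e =>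
        if e.1 e.2 = -1 then -(⟨(U e).1, Matrix.specialUnitaryGroup_le_unitaryGroup (U e).2⟩ :
          Matrix.unitaryGroup (Fin 3) ℂ) else ⟨(U e).1, Matrix.specialUnitaryGroup_le_unitaryGroup (U e).2⟩
      let w : GaugeConfig 4 N G → ℝ := fun U =>
        Real.exp (-(β * wilsonAction ρ U)) *
          (∏ f, fermionDet (wilsonDirac (unitaryFundamentalRep (Fin 3) ℂ) (apU U) (mq f) 1)).re
      Measurable w ∧ (0 < ∫ U, w U ∂μ) ∧
        (∀ v U, w (torusConfigShift v U) = w U) ∧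
        (∀ U, w (GaugeConfig.timeReflect U) = w U) ∧
        (∀ (π : Equiv.Perm (Fin 4)) U, w (U ∘ fun e => (e.1 ∘ π, π.symm e.2)) = w U) ∧
        (∀ F : GaugeConfig 4 N G → ℝ, Measurable F → (∃ C, ∀ U, |F U| ≤ C) →
          IsPositiveTimeObservable F → 0 ≤ ∫ U, F U.timeReflect * F U * w U ∂μ) := by
  intro Nf β mq hβ hmq S hS
  exact ⟨measurable_fineWeight β mq, fineWeight_partitionPos β mq hβ hmq S hS,
    fun v U => fineWeight_torusConfigShift β mq v U, fun U => fineWeight_timeReflect β mq U,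
    fun π U => fineWeight_axisPerm β mq π U,
    fun F hF hFb hFpos => fineWeight_rp β mq hβ hmq S hS F hF hFb hFpos⟩

/-- **The seven FINE-WEIGHT clauses of the rev-3 admissibility predicate** `AdmAt` of
`HeavyThresholdYMBridge.RobustYangMillsRG` (item stmt-QuantumFields-17812; rev 3 added the clause of GAUGE
INVARIANCE of the weight) for the all-axes-antiperiodic quark-integrated Wilson weight on the odd torus
`(ℤ/(2S+1))⁴`, `S ≥ 1`, `β ≥ 0`, `m_f > -1`, stated let-free in the tree's vocabulary
(`wilsonDiracAP U m = wilsonDirac (unitaryFundamentalRep (Fin 3) ℂ) (apLift U) m 1`, definitionally the skeleton's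
inlined lift): (1) measurability, (2) `Z > 0`, (2′) gauge invariance (`wilsonAction_gaugeTransform`,
`fermionDet_wilsonDiracAP_gaugeTransform`), (3) translations, (4) time reflection, (5) axis permutations,
(6) reflection positivity. Registered sub-goal `stubFW_admissible` of crux stmt-QuantumFields-18031. -/
theorem stubFW_admissible :
    ∀ (Nf : ℕ) (β : ℝ) (mq : Fin Nf → ℝ), 0 ≤ β → (∀ f, -1 < mq f) → ∀ (S : ℕ), 1 ≤ S → (Measurable fun U : GaugeConfig 4 (2 * S + 1) (Matrix.specialUnitaryGroup (Fin 3) ℂ) => Real.exp (-(β * wilsonAction (fundamentalRep (Fin 3)) U)) * (∏ f, fermionDet (wilsonDiracAP U (mq f))).re) ∧ (0 < ∫ U : GaugeConfig 4 (2 * S + 1) (Matrix.specialUnitaryGroup (Fin 3) ℂ), Real.exp (-(β * wilsonAction (fundamentalRep (Fin 3)) U)) * (∏ f, fermionDet (wilsonDiracAP U (mq f))).re ∂(Measure.pi fun _ => haarProbability (Matrix.specialUnitaryGroup (Fin 3) ℂ))) ∧ (∀ g (U : GaugeConfig 4 (2 * S + 1) (Matrix.specialUnitaryGroup (Fin 3)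 ℂ)), Real.exp (-(β * wilsonAction (fundamentalRep (Fin 3)) (gaugeTransform g U))) * (∏ f, fermionDet (wilsonDiracAP (gaugeTransform g U) (mq f))).re = Real.exp (-(β * wilsonAction (fundamentalRep (Fin 3)) U)) * (∏ f, fermionDet (wilsonDiracAP U (mq f))).re) ∧ (∀ (v : Site 4 (2 * S + 1)) (U : GaugeConfig 4 (2 * S + 1) (Matrix.specialUnitaryGroup (Fin 3) ℂ)), Real.exp (-(β * wilsonAction (fundamentalRep (Fin 3)) (torusConfigShift v U))) * (∏ f, fermionDet (wilsonDiracAP (torusConfigShift v U) (mq f))).re = Real.exp (-(β * wilsonAction (fundamentalRep (Fin 3)) U)) * (∏ f, fermionDet (wilsonDiracAP U (mq f))).re) ∧ (∀ U : GaugeConfig 4 (2 * S + 1) (Matrix.specialUnitaryGroup (Fin 3) ℂ), Real.exp (-(β * wilsonAction (fundamentalRep (Fin 3)) U.timeReflect)) * (∏ f, fermionDet (wilsonDiracAP U.timeReflect (mq f))).re = Real.exp (-(β * wilsonAction (fundamentalRep (Fin 3)) U)) * (∏ f, fermionDet (wilsonDiracAP U (mq f))).re) ∧ (∀ (π : Equiv.Perm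 (Fin 4)) (U : GaugeConfig 4 (2 * S + 1) (Matrix.specialUnitaryGroup (Fin 3) ℂ)), Real.exp (-(β * wilsonAction (fundamentalRep (Fin 3)) (U ∘ fun e => (e.1 ∘ ⇑π, π.symm e.2)))) * (∏ f, fermionDet (wilsonDiracAP (U ∘ fun e => (e.1 ∘ ⇑π, π.symm e.2)) (mq f))).re = Real.exp (-(β * wilsonAction (fundamentalRep (Fin 3)) U)) * (∏ f, fermionDet (wilsonDiracAP U (mq f))).re) ∧ (∀ F : GaugeConfig 4 (2 * S + 1) (Matrix.specialUnitaryGroup (Fin 3) ℂ) → ℝ, Measurable F → (∃ C, ∀ U, |F U| ≤ C) → IsPositiveTimeObservable F → 0 ≤ ∫ U : GaugeConfig 4 (2 * S + 1) (Matrix.specialUnitaryGroup (Fin 3) ℂ), F U.timeReflect * F U * (Real.exp (-(β * wilsonAction (fundamentalRep (Fin 3)) U)) * (∏ f, fermionDet (wilsonDiracAP U (mq f))).re) ∂(Measure.pi fun _ => haarProbability (Matrix.specialUnitaryGroup (Fin 3) ℂ))) := by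
  intro Nf β mq hβ hmq S hS
  exact ⟨measurable_fineWeight β mq, fineWeight_partitionPos β mq hβ hmq S hS,
    fun g U => by rw [wilsonAction_gaugeTransform, Finset.prod_congr rfl fun f _ =>
      fermionDet_wilsonDiracAP_gaugeTransform g U (mq f)],
    fun v U => fineWeight_torusConfigShift β mq v U, fun U => fineWeight_timeReflect β mq U,
    fun π U => fineWeight_axisPerm β mq π U,
    fun F hF hFb hFpos => fineWeight_rp β mq hβ hmq S hS F hF hFb hFpos⟩

end Stub

end Summit.QuantumFields.QCD.Cruxes.InterleavedFlowProper.OffsetLastFormatHandover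

end
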